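import Summits.ResolutionOfSingularities.ResolutionOfSingularities.Theorems.DeltaCutStellarLatLaw
import Summits.ResolutionOfSingularities.ResolutionOfSingularities.Theorems.DeltaCutStellarJetInhabitant

/-!
# StellarCut L20e — «LatentCut»: KERNEL INHABITANT of the latent class `ncHypShapeLat 2` — the kangaroo `x² + (1 + x)z²w²`

Route `MaxContactCut`, column `E1TopNoAbs`; lineage `decomp-res-lens-6` g36, WINDOW (W-Rest2) («A DECIDED on a typed, kernel-inhabited,
non-thin sub-class — kangaroo frame as natural inhabitant»).

On the coordinate model `Xs = Spec 𝔽₂[x₀,x₁,x₂]_{(x)}` (T19d-i `DeltaCutStellarJetModel`):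
* **THE LATENT INHABITANT** `fL = x₀² + x₀x₁²x₂² + x₁³x₂³ = x₀² + (x₀ + x₁x₂)·x₁x₂·x₁x₂`, framed by `(H = V(x₀); x₁ : 1, x₂ : 1)` with
  latent labels `(1, 1)`: `ncHypShapeLat_latent` (`h = x₀`, `m_b = m_μ = x₁x₂`, `c = −1`, `v = 1`; top locus on `V(x₀)` via `∂/∂x₁`,
  `support_ML_subset`), NON-DEGENERATE (`pt ∈ Supp ML`: `pt_mem_support_ML`; `pt ∈ V(H) ≠ ∅`: `H_support_nonempty` — neither the
  `∨ V(H) = ∅` escape of the label clauses nor an empty support is how it type-checks), of positive latent mass (`latMass_lat : latMass = 2`,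
  two codimension-two hops before the jet law), and RESOLVED BY THE LATENT LAW: `weakResolution_latent` (L20d
  `ncHypShapeLat.exists_weakResolution` applied to `ncHypShapeLat_latent` — not by hand).
* **IT IS THE KANGAROO.** `fL` is Hauser's `x² + (1 + x)z²w²` written in the regular parameters `x = x₀ + x₁x₂`, `z = x₁`, `w = x₂`:
  `kangaroo_identity : (x₀ + x₁x₂)² + (1 + (x₀ + x₁x₂))·x₁²x₂² = fL` (`2 = 0`).  In the model's own coordinates the kangaroo
  `fK = x₀² + (1 + x₀)x₁²x₂²` is a binomial hypersurface-shape datum on the KANGAROO FRAME `(V(x₀); x₁ : 2, x₂ : 2)`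
  (`ncHypShapeF_kangarooDatum`, unit `1 + x₀`; top locus via `∂/∂x₀`), admits NO jet datum there (`not_ncHypShapeJet_kangarooDatum`,
  T19d BY NAME) and is not coprime-labelled there (`not_ncHypShapeCop_kangarooDatum`): the test datum of `WORNCHypWildRest2`'s
  docstring, outside the jet and the coprime classes with its frame, inside the latent class with the frame `(V(x₀ + x₁x₂); x₁, x₂)`.
  NON-THINNESS vs Jet/Cop (paper, declared): the `𝔽₂`-automorphism `σ : x₀ ↦ x₀ + x₁x₂` of `S` fixes `x₁, x₂`, maps `fK ↦ fL`
  (`kangaroo_identity`) and the kangaroo frame `(V(x₀); 2, 2)` to `fL`'s binomial frame `(V(x₀ + x₁x₂); 2, 2)`; jet data and coprime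
  labels are transported by `σ`, so `fL` admits no jet datum and no coprime labelling on its binomial frame BECAUSE `fK` admits none on
  the kangaroo frame — KERNEL for `fK` (`not_ncHypShapeJet_kangarooDatum` = g35's `not_jetAt_pt` mechanism: closed point with both
  labels `2`-divisible; `not_ncHypShapeCop_kangarooDatum`), transport by `σ` on the desk.

0 sorry; axioms standard. [new] [cite: Hauser2010, §3 (the kangaroo phenomenon), §5]
-/

open CategoryTheory AlgebraicGeometry Literature.AlgebraicGeometry.Resolution IsLocalRing
open Summit.ResolutionOfSingularities.ResolutionOfSingularities.Theorems WeakOrderReduction ForcedTowerClasses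

namespace Summit.ResolutionOfSingularities.ResolutionOfSingularities.Theorems.DeltaCutClasses

namespace JetModel

/-! ## The latent datum `fL = x₀² + x₀x₁²x₂² + x₁³x₂³` on the frame `(V(x₀); x₁ : 1, x₂ : 1)` -/

/-- latent / terminal labels `(0, 1, 1)` on `(D 0, D 1, D 2)`. -/
def lat : Fin 3 → ℕ := ![0, 1, 1]

/-- Label of `H = D 0` is `0`. [folklore] -/
@[simp] theorem lat_zero : lat 0 = 0 := rfl
/-- Label of `D 1` is `1`. [folklore] -/
@[simp] theorem lat_one : lat 1 = 1 := rfl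
/-- Label of `D 2` is `1`. [folklore] -/
@[simp] theorem lat_two : lat 2 = 1 := rfl

/-- `fL = x₀² + x₀x₁²x₂² + x₁³x₂³`. -/
noncomputable abbrev fL : S := x 0 ^ 2 + x 0 * (x 1 ^ 2 * x 2 ^ 2) + x 1 ^ 3 * x 2 ^ 3

/-- the marked ideal `(fL~, 2)`. -/
noncomputable def ML : MarkedIdeal Xs := ⟨affineBlowup.idealSheaf (Ideal.span {fL}), [], 2⟩

/-- The ideal of the latent datum is `(fL)`. [folklore] -/
theorem ML_ideal : ML.ideal = affineBlowup.idealSheaf (Ideal.span {fL}) := rfl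

/-- The marking of the latent datum is `2`. [folklore] -/
theorem ML_mult : ML.mult = 2 := rfl

/-- The frame monomial of the labels `lat` is `x 1 * x 2`. [folklore] -/
theorem prod_lat : ∏ j, x j ^ lat j = x 1 * x 2 := by
  simp [Fin.prod_univ_three]

/-- The monomial ideal sheaf of `frame lat` is `(x 1 * x 2)`. [folklore] -/
theorem monomialIdeal_lat : monomialIdeal (frame lat) = affineBlowup.idealSheaf (Ideal.span {x 1 * x 2}) := by
  rw [monomialIdeal_frame, prod_lat]

/-- `∂fL/∂x₁ = x₁²x₂³` in `S` (`2 = 0`, `3 = 1`). [folklore] -/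
theorem exists_isDeriv_fL : ∃ δ : S → S, IsDeriv δ ∧ δ fL = x 1 ^ 2 * x 2 ^ 3 := by
  obtain ⟨δ, hδ, he⟩ := (IsDeriv.of_derivation (MvPolynomial.pderiv (R := ZMod 2) (σ := Fin 3) 1)).exists_extend S
    (originIdeal (ZMod 2) 3).primeCompl
  refine ⟨δ, hδ, ?_⟩
  have hF : fL = algebraMap P S
      (MvPolynomial.X 0 ^ 2 + MvPolynomial.X 0 * (MvPolynomial.X 1 ^ 2 * MvPolynomial.X 2 ^ 2) +
        MvPolynomial.X 1 ^ 3 * MvPolynomial.X 2 ^ 3) := by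
    simp only [map_add, map_mul, map_pow]
  have hd : MvPolynomial.pderiv (1 : Fin 3)
      ((MvPolynomial.X 0 ^ 2 + MvPolynomial.X 0 * (MvPolynomial.X 1 ^ 2 * MvPolynomial.X 2 ^ 2) +
        MvPolynomial.X 1 ^ 3 * MvPolynomial.X 2 ^ 3 : P)) =
      2 * (MvPolynomial.X 0 * MvPolynomial.X 1 * MvPolynomial.X 2 ^ 2) + 3 * (MvPolynomial.X 1 ^ 2 * MvPolynomial.X 2 ^ 3) := by
    simp only [map_add, Derivation.leibniz, Derivation.leibniz_pow, MvPolynomial.pderiv_X_self,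
      MvPolynomial.pderiv_X_of_ne (show (0 : Fin 3) ≠ 1 by decide),
      MvPolynomial.pderiv_X_of_ne (show (2 : Fin 3) ≠ 1 by decide), smul_zero, smul_eq_mul, nsmul_eq_mul,
      mul_zero, zero_add, add_zero, mul_one]
    push_cast
    ring
  rw [hF, he, hd]
  simp only [map_add, map_mul, map_pow, map_ofNat, two_eq_zero, three_eq_one, zero_mul, zero_add, one_mul]

/-- `∂/∂x₁` on the stalk, with its value on `fL`. [folklore] -/
theorem exists_isDeriv_fL_stalk (p : Xs) :
    ∃ δ : Xs.presheaf.stalk p → Xs.presheaf.stalk p, IsDeriv δ ∧ δ (φ p fL) = φ p (x 1 ^ 2 * x 2 ^ 3) := by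
  letI := stalkAlgebra p
  haveI := isLocalizationAtPrime_stalk p
  obtain ⟨δ, hδ, hf⟩ := exists_isDeriv_fL
  obtain ⟨δ', hδ', he⟩ := hδ.exists_extend (Xs.presheaf.stalk p) p.asIdeal.primeCompl
  exact ⟨δ', hδ', by rw [show φ p fL = algebraMap S _ fL from rfl, he, hf]⟩

/-- **`Supp(fL~, 2) ⊆ V(x₀)`** — via `∂/∂x₁`: `fL ∈ 𝔪_𝔭²𝒪_𝔭 ⇒ x₁²x₂³ ∈ 𝔭 ⇒ x₁x₂ ∈ 𝔭 ⇒ x₀² = fL − x₀x₁²x₂² − x₁³x₂³ ∈ 𝔭`.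
[folklore] -/
theorem support_ML_subset : (ML.support : Set Xs) ⊆ H.support := by
  intro p hp
  have hle : stalkIdeal ML.ideal p ≤ maximalIdeal _ ^ 2 := (MarkedIdeal.mem_support_iff ML p).mp hp
  rw [ML_ideal, stalkIdeal_span] at hle
  have hf2 : φ p fL ∈ maximalIdeal _ ^ 2 := hle (Ideal.mem_span_singleton_self _)
  have hf1 : fL ∈ p.asIdeal := (mem_maximalIdeal_iff p fL).mp (Ideal.pow_le_self two_ne_zero hf2)
  obtain ⟨δ, hδ, hδf⟩ := exists_isDeriv_fL_stalk p
  have h12 : x 1 ^ 2 * x 2 ^ 3 ∈ p.asIdeal := by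
    rw [← mem_maximalIdeal_iff p, ← hδf]
    exact hδ.apply_mem_of_mem_sq _ hf2
  have h12' : x 1 * x 2 ∈ p.asIdeal := by
    rcases p.2.mem_or_mem h12 with h | h
    · exact p.asIdeal.mul_mem_right _ (p.2.mem_of_pow_mem 2 h)
    · exact p.asIdeal.mul_mem_left _ (p.2.mem_of_pow_mem 3 h)
  have hx0 : x 0 ^ 2 ∈ p.asIdeal := by
    have h1 : x 0 * (x 1 ^ 2 * x 2 ^ 2) ∈ p.asIdeal := by
      have : x 0 * (x 1 ^ 2 * x 2 ^ 2) = x 0 * (x 1 * x 2) * (x 1 * x 2) := by ring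
      rw [this]
      exact p.asIdeal.mul_mem_left _ h12'
    have h2 : x 1 ^ 3 * x 2 ^ 3 ∈ p.asIdeal := by
      have : x 1 ^ 3 * x 2 ^ 3 = x 1 ^ 2 * x 2 ^ 2 * (x 1 * x 2) := by ring
      rw [this]
      exact p.asIdeal.mul_mem_left _ h12'
    have := p.asIdeal.sub_mem (p.asIdeal.sub_mem hf1 h2) h1
    rwa [add_sub_cancel_right, add_sub_cancel_right] at this
  exact (mem_support_D 0 p).mpr (p.2.mem_of_pow_mem 2 hx0)

/-- ★ **THE KERNEL INHABITANT OF THE LATENT CLASS.** `fL = x₀² + (x₀ + x₁x₂)·x₁x₂·x₁x₂` framed by `(V(x₀); x₁ : 1, x₂ : 1)` with latent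
labels `(1, 1)` IS in `ncHypShapeLat 2` (`h = x₀`, `m_b = m_μ = x₁x₂`, `c = −1`, `v = 1`; terminal labels `1, 1` odd). [new] -/
theorem ncHypShapeLat_latent : ncHypShapeLat 2 Xs (frame lat) (frame lat) H ML := by
  refine ⟨rfl, fun q hq hqH => ?_, fun q hq hqH => ?_, rfl, fun y _ => ?_, support_ML_subset, Nat.prime_two,
    two_eq_zero_stalk, fun K y _ => ?_⟩
  · obtain ⟨j, rfl⟩ := (List.mem_ofFn' _ _).mp hq
    have hj : j = 0 := D_injective hqH
    subst hj
    exact Or.inl rfl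
  · obtain ⟨j, rfl⟩ := (List.mem_ofFn' _ _).mp hq
    have hj : j = 0 := D_injective hqH
    subst hj
    exact Or.inl rfl
  · refine ⟨φ y (x 0), φ y (x 1 * x 2), φ y (x 1 * x 2), -1, 1, isUnit_one.neg, isUnit_one, stalkIdeal_span _ _, ?_, ?_, ?_⟩
    · rw [monomialIdeal_lat, stalkIdeal_span]
    · rw [monomialIdeal_lat, stalkIdeal_span]
    · rw [ML_ideal, stalkIdeal_span]
      congr 1
      simp only [Set.singleton_eq_singleton_iff, map_add, map_mul, map_pow]
      ring
  · by_cases hj : ∃ j, D j = K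
    · obtain ⟨j, rfl⟩ := hj
      rw [expOf_frame]
      have : ∀ j : Fin 3, lat j = 0 ∨ ¬ 2 ∣ lat j := by decide
      exact this j
    · exact Or.inl (expOf_frame_eq_zero lat fun j h => hj ⟨j, h⟩)

/-- ★ **NON-THIN**: the latent mass of the inhabitant is `2` — both latent members `V(x₁)`, `V(x₂)` meet `V(x₀)` (at the closed point)
with latent label `1`: the latent law performs TWO codimension-two hops before T16's strategy (the datum is not terminal). [new] -/
theorem latMass_lat : latMass (frame lat) H = 2 := by
  classical
  have hne : ∀ j : Fin 3, (((D j).support : Set Xs) ∩ H.support).Nonempty := fun j =>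
    ⟨pt, pt_mem_support_D j, pt_mem_support_D 0⟩
  rw [latMass, List.map_ofFn, List.sum_ofFn]
  simp only [Function.comp_def]
  rw [Fin.sum_univ_three, if_pos (hne 0), if_pos (hne 1), if_pos (hne 2)]
  rfl

/-- the inhabitant is not terminal: `ncHypShapeLat.toCop` does not apply at round `0` (mass `≠ 0`). -/
theorem latMass_lat_ne_zero : latMass (frame lat) H ≠ 0 := by
  rw [latMass_lat]; decide

/-- **non-degeneracy**: the closed point is a point of order `2` of `fL`, i.e. `pt ∈ Supp(ML)`. [new] -/
theorem pt_mem_support_ML : pt ∈ ML.support := by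
  rw [MarkedIdeal.mem_support_iff, ML_ideal, stalkIdeal_span, ML_mult, Ideal.span_le, Set.singleton_subset_iff,
    SetLike.mem_coe, maximalIdeal_stalk_eq, pt_asIdeal, ← Ideal.map_pow]
  refine Ideal.mem_map_of_mem _ ?_
  rw [pow_two]
  refine Ideal.add_mem _ (Ideal.add_mem _ (by rw [pow_two]; exact Ideal.mul_mem_mul (x_mem 0) (x_mem 0)) ?_) ?_
  · exact Ideal.mul_mem_mul (x_mem 0) (Ideal.mul_mem_right _ _ (Ideal.pow_mem_of_mem _ (x_mem 1) 2 (by norm_num)))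
  · exact Ideal.mul_mem_mul (Ideal.pow_mem_of_mem _ (x_mem 1) 3 (by norm_num)) (Ideal.pow_mem_of_mem _ (x_mem 2) 3 (by norm_num))

/-- `V(H) ∋ pt` is non-empty: the `∨ V(H) = ∅` escape of the label clauses is NOT how the inhabitant type-checks. [folklore] -/
theorem H_support_nonempty : pt ∈ H.support ∧ (H.support : Set Xs) ≠ ∅ :=
  ⟨pt_mem_support_D 0, Set.nonempty_iff_ne_empty.mp ⟨pt, pt_mem_support_D 0⟩⟩

/-- … its frame is s.n.c. with `H` a member, the closed point lies in the support, and the latent mass is positive. [new] -/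
theorem lat_nondegenerate :
    HasSNC (H :: boundaryOf (frame lat)) ∧ H ∈ boundaryOf (frame lat) ∧ pt ∈ ML.support ∧ latMass (frame lat) H = 2 :=
  ⟨hasSNC_frame _, H_mem_boundaryOf_frame _, pt_mem_support_ML, latMass_lat⟩

/-- ★★ **A WEAK RESOLUTION OF THE KANGAROO, by the latent law (L20d).** [new] -/
theorem weakResolution_latent : ∃ s : CentreSeq Xs, WeakResolution s ML :=
  ncHypShapeLat_latent.exists_weakResolution (hasSNC_frame _) (H_mem_boundaryOf_frame _)

/-! ## The kangaroo `fK = x₀² + (1 + x₀)x₁²x₂²` in the model's own coordinates -/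

/-- `fK = x₀² + (1 + x₀)·x₁²x₂²` — Hauser's kangaroo `x² + (1 + x)z²w²` verbatim (`x₀ = x`, `x₁ = z`, `x₂ = w`). -/
noncomputable abbrev fK : S := x 0 ^ 2 + (1 + x 0) * (x 1 ^ 2 * x 2 ^ 2)

/-- ★ **`fL` IS THE KANGAROO in the regular parameters `(x₀ + x₁x₂, x₁, x₂)`**: substituting `x₀ ↦ x₀ + x₁x₂` in `fK` gives `fL`
(`2 = 0` in `S`). [new] -/
theorem kangaroo_identity : (x 0 + x 1 * x 2) ^ 2 + (1 + (x 0 + x 1 * x 2)) * (x 1 ^ 2 * x 2 ^ 2) = fL := by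
  linear_combination (x 0 * x 1 * x 2 + x 1 ^ 2 * x 2 ^ 2) * two_eq_zero

/-- the marked ideal `(fK~, 2)`. -/
noncomputable def MK : MarkedIdeal Xs := ⟨affineBlowup.idealSheaf (Ideal.span {fK}), [], 2⟩

/-- The ideal of the kangaroo datum is `(fK)`. [folklore] -/
theorem MK_ideal : MK.ideal = affineBlowup.idealSheaf (Ideal.span {fK}) := rfl

/-- The marking of the kangaroo datum is `2`. [folklore] -/
theorem MK_mult : MK.mult = 2 := rfl

/-- The frame monomial of the kangaroo labels is `x 1 ^ 2 * x 2 ^ 2`. [folklore] -/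
theorem prod_kangaroo : ∏ j, x j ^ kangaroo j = x 1 ^ 2 * x 2 ^ 2 := by
  simp [Fin.prod_univ_three, kangaroo]

/-- The monomial ideal sheaf of the kangaroo frame is `(x 1 ^ 2 * x 2 ^ 2)`. [folklore] -/
theorem monomialIdeal_kangaroo : monomialIdeal (frame kangaroo) = affineBlowup.idealSheaf (Ideal.span {x 1 ^ 2 * x 2 ^ 2}) := by
  rw [monomialIdeal_frame, prod_kangaroo]

/-- `∂fK/∂x₀ = x₁²x₂²` in `S` (`2 = 0`). [folklore] -/
theorem exists_isDeriv_fK : ∃ δ : S → S, IsDeriv δ ∧ δ fK = x 1 ^ 2 * x 2 ^ 2 := by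
  obtain ⟨δ, hδ, he⟩ := (IsDeriv.of_derivation (MvPolynomial.pderiv (R := ZMod 2) (σ := Fin 3) 0)).exists_extend S
    (originIdeal (ZMod 2) 3).primeCompl
  refine ⟨δ, hδ, ?_⟩
  have hF : fK = algebraMap P S
      (MvPolynomial.X 0 ^ 2 + (1 + MvPolynomial.X 0) * (MvPolynomial.X 1 ^ 2 * MvPolynomial.X 2 ^ 2)) := by
    simp only [map_add, map_mul, map_pow, map_one]
  have hd : MvPolynomial.pderiv (0 : Fin 3)
      ((MvPolynomial.X 0 ^ 2 + (1 + MvPolynomial.X 0) * (MvPolynomial.X 1 ^ 2 * MvPolynomial.X 2 ^ 2) : P)) =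
      2 * MvPolynomial.X 0 + MvPolynomial.X 1 ^ 2 * MvPolynomial.X 2 ^ 2 := by
    simp only [map_add, Derivation.map_one_eq_zero, Derivation.leibniz, Derivation.leibniz_pow, MvPolynomial.pderiv_X_self,
      MvPolynomial.pderiv_X_of_ne (show (1 : Fin 3) ≠ 0 by decide),
      MvPolynomial.pderiv_X_of_ne (show (2 : Fin 3) ≠ 0 by decide), smul_zero, smul_eq_mul, nsmul_eq_mul,
      mul_zero, zero_add, add_zero, mul_one]
    push_cast
    ring
  rw [hF, he, hd]
  simp only [map_add, map_mul, map_pow, map_ofNat, two_eq_zero, zero_mul, zero_add]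

/-- `∂/∂x₀` on the stalk, with its value on `fK`. [folklore] -/
theorem exists_isDeriv_fK_stalk (p : Xs) :
    ∃ δ : Xs.presheaf.stalk p → Xs.presheaf.stalk p, IsDeriv δ ∧ δ (φ p fK) = φ p (x 1 ^ 2 * x 2 ^ 2) := by
  letI := stalkAlgebra p
  haveI := isLocalizationAtPrime_stalk p
  obtain ⟨δ, hδ, hf⟩ := exists_isDeriv_fK
  obtain ⟨δ', hδ', he⟩ := hδ.exists_extend (Xs.presheaf.stalk p) p.asIdeal.primeCompl
  exact ⟨δ', hδ', by rw [show φ p fK = algebraMap S _ fK from rfl, he, hf]⟩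

/-- **`Supp(fK~, 2) ⊆ V(x₀)`** — via `∂/∂x₀`: `fK ∈ 𝔪_𝔭²𝒪_𝔭 ⇒ x₁²x₂² ∈ 𝔭 ⇒ x₀² = fK − (1 + x₀)x₁²x₂² ∈ 𝔭`. [folklore] -/
theorem support_MK_subset : (MK.support : Set Xs) ⊆ H.support := by
  intro p hp
  have hle : stalkIdeal MK.ideal p ≤ maximalIdeal _ ^ 2 := (MarkedIdeal.mem_support_iff MK p).mp hp
  rw [MK_ideal, stalkIdeal_span] at hle
  have hf2 : φ p fK ∈ maximalIdeal _ ^ 2 := hle (Ideal.mem_span_singleton_self _)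
  have hf1 : fK ∈ p.asIdeal := (mem_maximalIdeal_iff p fK).mp (Ideal.pow_le_self two_ne_zero hf2)
  obtain ⟨δ, hδ, hδf⟩ := exists_isDeriv_fK_stalk p
  have h12 : x 1 ^ 2 * x 2 ^ 2 ∈ p.asIdeal := by
    rw [← mem_maximalIdeal_iff p, ← hδf]
    exact hδ.apply_mem_of_mem_sq _ hf2
  have hx0 : x 0 ^ 2 ∈ p.asIdeal := by
    have := p.asIdeal.sub_mem hf1 (p.asIdeal.mul_mem_left (1 + x 0) h12)
    rwa [add_sub_cancel_right] at this
  exact (mem_support_D 0 p).mpr (p.2.mem_of_pow_mem 2 hx0)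

/-- **THE KANGAROO IS A BINOMIAL HYPERSURFACE-SHAPE DATUM on the kangaroo frame** `(V(x₀); x₁ : 2, x₂ : 2)`: `fK = h² + u·m` with
`h = x₀`, `m = x₁²x₂²`, `u = 1 + x₀` a unit along `V(x₀)` (the unit-free NC-hyp shape `ncHypShapeF 2`, T17a). [new] -/
theorem ncHypShapeF_kangarooDatum : ncHypShapeF 2 Xs (frame kangaroo) H MK := by
  refine ⟨rfl, fun q hq hqH => ?_, fun y hy => ?_, support_MK_subset⟩
  · obtain ⟨j, rfl⟩ := (List.mem_ofFn' _ _).mp hq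
    have hj : j = 0 := D_injective hqH
    subst hj
    exact Or.inl rfl
  · have hu : IsUnit (φ y (1 + x 0)) := by
      refine (isUnit_iff y _).mpr fun h1 => y.2.ne_top ((Ideal.eq_top_iff_one _).mpr ?_)
      have := y.asIdeal.sub_mem h1 ((mem_support_D 0 y).mp hy)
      rwa [add_sub_cancel_right] at this
    refine ⟨φ y (x 0), φ y (x 1 ^ 2 * x 2 ^ 2), φ y (1 + x 0), hu, stalkIdeal_span _ _, ?_, ?_⟩
    · rw [monomialIdeal_kangaroo, stalkIdeal_span]
    · rw [MK_ideal, stalkIdeal_span, ← map_pow, ← map_mul, ← map_add]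

/-- **… with NO JET DATUM on that frame** (T19d `not_ncHypShapeJet_kangaroo`, BY NAME): the kangaroo with its frame is outside the jet
class. [new] -/
theorem not_ncHypShapeJet_kangarooDatum : ¬ ncHypShapeJet 2 Xs (frame kangaroo) H MK := not_ncHypShapeJet_kangaroo MK

/-- **… and NOT COPRIME-LABELLED there** (labels `2, 2` even, through the closed point): outside T18's class with its frame. [new] -/
theorem not_ncHypShapeCop_kangarooDatum : ¬ ncHypShapeCop 2 Xs (frame kangaroo) H MK := by
  rintro ⟨-, -, -, hcop⟩
  rcases hcop (D 1) pt (pt_mem_support_D 1) with h | h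
  · rw [expOf_frame] at h
    exact absurd h (by decide)
  · rw [expOf_frame] at h
    exact h (by decide)

/-- **non-degeneracy of the kangaroo**: s.n.c. frame through `H`, `H` a member, the closed point of order `2`. [new] -/
theorem kangarooDatum_nondegenerate :
    HasSNC (H :: boundaryOf (frame kangaroo)) ∧ H ∈ boundaryOf (frame kangaroo) ∧ pt ∈ MK.support := by
  refine ⟨hasSNC_frame _, H_mem_boundaryOf_frame _, ?_⟩
  rw [MarkedIdeal.mem_support_iff, MK_ideal, stalkIdeal_span, MK_mult, Ideal.span_le, Set.singleton_subset_iff,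
    SetLike.mem_coe, maximalIdeal_stalk_eq, pt_asIdeal, ← Ideal.map_pow]
  refine Ideal.mem_map_of_mem _ ?_
  rw [pow_two]
  refine Ideal.add_mem _ (by rw [pow_two]; exact Ideal.mul_mem_mul (x_mem 0) (x_mem 0)) (Ideal.mul_mem_left _ _ ?_)
  rw [show x 1 ^ 2 * x 2 ^ 2 = (x 1 * x 2) * (x 1 * x 2) by ring]
  exact Ideal.mul_mem_mul (Ideal.mul_mem_right _ _ (x_mem 1)) (Ideal.mul_mem_right _ _ (x_mem 1))

end JetModel

end Summit.ResolutionOfSingularities.ResolutionOfSingularities.Theorems.DeltaCutClasses
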